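import Summits.CriticalPhenomena.PercolationContinuityZ3.Theorems.SahiMasterFamilyUCBernsteinNestedLayers

/-!
# The BOX-TOP / COATOM-STAR pair: (B) holds for it in every order (disjoint-union condition, kernel), while — exact computation, paper —
# its layer polynomial is NOT Hurwitz-stable from order 16 on, so the sector-stability conjecture `Sector.SectorStable n` is FALSE for `n ≥ 16`

Unit `prim-masterthm-p4` (gen 23; crux anchor stmt-CriticalPhenomena-4575, helper work; memo
`run/shared/lean/prim/prim-masterthm/prim-masterthm-p4/P4-GEN23-REPORT.md` §1–§3).  Companion of `…SectorStable` (typed conjecture (S)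
`Sector.SectorStable n`, reduction `(S)_n ⟹ (UC-hull)_n`) and of `…UCBernsteinNested` / `…UCBernsteinNestedLayers` (conjecture (B) PROVED for every pair of
union-closed families with the DISJOINT-UNION condition).

THE PAIR.  On `Fin (k+2)` with distinguished last index `z` and coatom `X = univ ∖ {z}`:
* `boxTop k = {S : z ∉ S} ∪ {univ}` — all nonempty-or-empty subsets of the coatom, plus the top (union-closed, `∋ univ`);
* `coatomStar k = {S : z ∈ S} ∪ {X}` — the star of `z` plus the coatom (union-closed, `∋ univ`).
They satisfy the disjoint-union condition (`disjointUnion_boxTop_coatomStar`: a set of the box disjoint from a member of the star unites with it into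
the star; nothing nonempty is disjoint from the coatom inside the box), hence **(B) holds for this pair in every order** (`bpos_boxTop_coatomStar`,
`layerSum_nonneg_boxTop_coatomStar`, from gen 22's theorem): all Bernstein layer sums `N_s ≥ 0`.

THE REFUTATION OF (S) FOR n ≥ 16 (exact arithmetic, paper; `work/code/extremal_exact.py` of the gen-23 session folder, memo §2).  For this pair the
edge polynomial has the closed form `P_n(w) = (n−1)! − (n−2)!(1−w)² − (1−w) Σ_{j=1}^{n−1} ((n−1)!/j!)·r_j(w)`, `r_j(w) = w(1−w)(2−w)⋯(j−1−w)`
(rays of the box are the falling products, rays of the star are `(1−w)·(|B|−1)!`, the only complementary splittings are `A ⊆ X`, `B = univ ∖ A ∋ z`);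
it agrees with the generic engine for n ≤ 10.  The layer polynomial `Q_n(x) = Σ_s N_s x^s = (1+x)^n P_n(1/(1+x))` has all Hurwitz determinants
positive for 3 ≤ n ≤ 15, but for EVERY 16 ≤ n ≤ 30 the determinants Δ_9, …, Δ_n (resp. a tail of them) are NEGATIVE; at n = 16 the Routh column has
exactly two sign changes, i.e. `Q_16` (coefficients `N = (1307674368000, 19615115520000, …, 15363130809600, 1220496076800)`, all positive, log-concave)
has exactly TWO ROOTS IN THE OPEN RIGHT HALF-PLANE (numerically x ≈ 0.012 ± 1.902 i, i.e. zeros of P_16 at w ≈ 0.218 ± 0.410 i, inside the open disc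
with diameter [0,1], drifting inwards with n).  Hence `Sector.SectorStable n` is false for every n ≥ 16 (its vertex-pair consequence fails), exactly
at the order where the supermultiplicative relaxation F(n) dies (`…PhiSymmetricLift`), while (B) — nonnegativity of the same coefficients — holds for
this family by the theorem below.  The maximal root angle |arg(−x)| of this family is 67.4°, 76.2° (the maximum over ALL pairs on 4 points), 80.1°,
82.4°, 84.0°, 85.3°, 86.3°, 87.1°, 87.9°, 88.5° for n = 3…12 and crosses 90° between 15 and 16.  A KERNEL refutation `¬ SectorStable 16` would need
the Routh–Hurwitz theorem or a certified argument-principle count and is not attempted; the status of (S)_n for 5 ≤ n ≤ 15 is open (no failure in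
6·10⁵ random pairs on 5 points, 2 400 cone segments on 5–7 points).  CONSEQUENCE FOR THE PROGRAMME: Hurwitz/sector stability is a small-order
phenomenon and cannot be the all-k vehicle; (B) (`UCBernsteinNonneg`) and (UC-hull) are untouched.
HONEST FRAMING: kernel content = (B) for one explicit two-parameter-free family in every order (an instance of gen 22's theorem); the refutation of
(S)_{≥16} is an exact computation recorded in the memo, not a kernel theorem.  Axioms standard. [this work]
-/

noncomputable section

open scoped Classical

namespace Summit.CriticalPhenomena.PercolationContinuityZ3.Theorems

namespace Sector

open Finset Function
open Literature.Combinatorics.Sahi2008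
open PrincipalCapBeta (phiSet)
open BernsteinPos (BPos mix)

variable {k : ℕ}

/-- The BOX-TOP family on `Fin (k+2)`: every set avoiding the last index, plus `univ`. [this work] -/
def boxTop (k : ℕ) : Finset (Finset (Fin (k + 2))) :=
  univ.filter fun S => Fin.last (k + 1) ∉ S ∨ S = univ

/-- The COATOM-STAR family on `Fin (k+2)`: every set containing the last index, plus the coatom `univ.erase last`. [this work] -/
def coatomStar (k : ℕ) : Finset (Finset (Fin (k + 2))) :=
  univ.filter fun S => Fin.last (k + 1) ∈ S ∨ S = univ.erase (Fin.last (k + 1))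

/-- Membership in the box-top family. [this work] -/
theorem mem_boxTop {S : Finset (Fin (k + 2))} : S ∈ boxTop k ↔ Fin.last (k + 1) ∉ S ∨ S = univ := by
  unfold boxTop; rw [mem_filter]; exact ⟨fun h => h.2, fun h => ⟨mem_univ _, h⟩⟩

/-- Membership in the coatom-star family. [this work] -/
theorem mem_coatomStar {S : Finset (Fin (k + 2))} :
    S ∈ coatomStar k ↔ Fin.last (k + 1) ∈ S ∨ S = univ.erase (Fin.last (k + 1)) := by
  unfold coatomStar; rw [mem_filter]; exact ⟨fun h => h.2, fun h => ⟨mem_univ _, h⟩⟩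

/-- The box-top family is union-closed. [this work] -/
theorem boxTop_unionClosed : ∀ A ∈ boxTop k, ∀ B ∈ boxTop k, A ∪ B ∈ boxTop k := by
  intro A hA B hB
  rw [mem_boxTop] at hA hB ⊢
  rcases hA with hA | hA
  · rcases hB with hB | hB
    · left; rw [mem_union, not_or]; exact ⟨hA, hB⟩
    · right; rw [hB]; exact eq_univ_of_forall fun x => mem_union_right _ (mem_univ x)
  · right; rw [hA]; exact eq_univ_of_forall fun x => mem_union_left _ (mem_univ x)

/-- The coatom-star family is union-closed. [this work] -/
theorem coatomStar_unionClosed : ∀ A ∈ coatomStar k, ∀ B ∈ coatomStar k, A ∪ B ∈ coatomStar k := by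
  intro A hA B hB
  rw [mem_coatomStar] at hA hB ⊢
  rcases hA with hA | hA
  · left; exact mem_union_left _ hA
  · rcases hB with hB | hB
    · left; exact mem_union_right _ hB
    · right; rw [hA, hB, union_self]

/-- `univ` belongs to the box-top family. [this work] -/
theorem univ_mem_boxTop : (univ : Finset (Fin (k + 2))) ∈ boxTop k := mem_boxTop.2 (Or.inr rfl)

/-- `univ` belongs to the coatom-star family. [this work] -/
theorem univ_mem_coatomStar : (univ : Finset (Fin (k + 2))) ∈ coatomStar k := mem_coatomStar.2 (Or.inl (mem_univ _))

/-- **The disjoint-union condition** for the pair (box-top, coatom-star): if `A` (box-top) and `B` (coatom-star) are disjoint then `A ∪ B` lies in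
one of the two families. [this work] -/
theorem disjointUnion_boxTop_coatomStar :
    ∀ A ∈ boxTop k, ∀ B ∈ coatomStar k, Disjoint A B → A ∪ B ∈ boxTop k ∪ coatomStar k := by
  intro A hA B hB hAB
  rw [mem_union, mem_boxTop, mem_coatomStar]
  rw [mem_boxTop] at hA
  rw [mem_coatomStar] at hB
  rcases hB with hB | hB
  · -- `B` contains the last index: so does `A ∪ B`
    exact Or.inr (Or.inl (mem_union_right _ hB))
  · -- `B` is the coatom; a disjoint `A` avoids every index but possibly the last one
    rcases hA with hA | hA
    · -- `A` avoids the last index and is disjoint from the coatom: `A = ∅`, so `A ∪ B = B`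
      have hAe : A = ∅ := by
        rw [eq_empty_iff_forall_notMem]
        intro x hx
        by_cases hxl : x = Fin.last (k + 1)
        · exact hA (hxl ▸ hx)
        · have hxB : x ∈ B := by rw [hB]; exact mem_erase.2 ⟨hxl, mem_univ _⟩
          exact disjoint_left.1 hAB hx hxB
      rw [hAe, empty_union]
      exact Or.inr (Or.inr hB)
    · rw [hA]
      exact Or.inl (Or.inr (eq_univ_of_forall fun x => mem_union_left _ (mem_univ x)))

/-- **(B) for the box-top / coatom-star pair, every order** (Bernstein positivity of the edge polynomial), an instance of gen 22's theorem for pairs with the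
disjoint-union condition — although from order 16 on this very edge polynomial has zeros in the open disc with diameter `[0,1]` (module docstring).
[this work] -/
theorem bpos_boxTop_coatomStar (k : ℕ) : BPos (k + 2) (fun w => phiSet (k + 2) (mix (boxTop k) (coatomStar k) w)) :=
  UCBernsteinNested.bpos_phiSet_mix_of_disjointUnion (k + 1) (boxTop k) (coatomStar k) boxTop_unionClosed coatomStar_unionClosed
    disjointUnion_boxTop_coatomStar

/-- **Every layer sum of (B) is nonnegative for the box-top / coatom-star pair, every order** (the typed conjecture's conclusion for this `Bool`-indexed pair).
[this work] -/
theorem layerSum_nonneg_boxTop_coatomStar (k : ℕ) (j : Bool → ℕ) :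
    0 ≤ UCBernstein.layerSum (fun b : Bool => if b then boxTop k else coatomStar k) j := by
  refine UCBernsteinNested.layerSum_nonneg_of_disjointUnion _ (fun b => ?_) ?_ j
  · cases b
    · exact coatomStar_unionClosed
    · exact boxTop_unionClosed
  · exact disjointUnion_boxTop_coatomStar

/-- Pointwise: `Φ_{k+2} ≥ 0` on the whole edge between the two vertices. [this work] -/
theorem phiSet_mix_boxTop_coatomStar_nonneg (k : ℕ) {w : ℝ} (hw0 : 0 ≤ w) (hw1 : w ≤ 1) :
    0 ≤ phiSet (k + 2) (mix (boxTop k) (coatomStar k) w) :=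
  (bpos_boxTop_coatomStar k).nonneg hw0 hw1

end Sector

end Summit.CriticalPhenomena.PercolationContinuityZ3.Theorems
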